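import Summits.AtomisticToContinuum.Crystallization.Theorems.ChargedEnergyGap.Negative.BlocksBound
import Summits.AtomisticToContinuum.Crystallization.Theorems.ChargedEnergyGap.Negative.BlocksLocal
import Summits.AtomisticToContinuum.Crystallization.Theorems.ReggeStarCoercivityPeriodicStarCoercivityDefs
import Summits.AtomisticToContinuum.Crystallization.Theorems.ReggeStarCoercivityPeriodicStarCoercivityCollarCount
import HarnessLib

/-!
# `PeriodicStarCoercivity` (route `ReggeStarCoercivity`, stmt-AtomisticToContinuum-13602), line `pinned-equilibria-reduction`:
stub T1 `stub_blockShell` — deep block points read the shells of `P`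

Registered stub (skeleton rev 5 of the line).  For a block index `u = (s, k)` of the `K`-block of a periodic
configuration `P` of `ℝ³` (landed block API `ChargedEnergyGapNegative.Blocks`: the block is the finite injective
configuration `blockConfig P K : Fin #block → ℝ³`, `blockConfig P K a = bpt P K ((Fintype.equivFin _).symm a)`,
`bpt P K u = s + latVec P (coords K k) ∈ P.points`) whose lattice coordinates `k` are `depth P 2`-deep, the crux's
FINITE shell of the block configuration at the `Fin`-index of `u` (other block points within `6/5`, recentred,
rescaled by `a⁻¹`) equals the PERIODIC shell `shell P (bpt P K u) a` read in `P.points` (vocabulary of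
`Theorems/ReggeStarCoercivityPeriodicStarCoercivityDefs.lean`).

Proof: block points are points of `P` (`bpt_mem`) and pairwise distinct (`blockConfig_injective`), which gives
`⊆`; conversely every point of `P.points` within distance `< 2` of a `depth P 2`-deep block point is itself a
block point (`exists_eq_toP_of_dist_lt`), and `6/5 < 2`, which gives `⊇`.  All `[folklore]`.
-/

noncomputable section

open scoped BigOperators Classical
open Literature.MathematicalPhysics.StatisticalMechanics Literature.Geometry.DiscreteGeometry
open Summit.AtomisticToContinuum.Crystallization.Theorems.ChargedEnergyGapNegative.Blocks

namespace Summit.AtomisticToContinuum.Crystallization.Theorems.ReggeStarCoercivityPeriodicStarCoercivity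

/-- **Stub T1 `stub_blockShell` of the line `pinned-equilibria-reduction`** (crux
`ReggeStarCoercivity.PeriodicStarCoercivity`, stmt-AtomisticToContinuum-13602): at a block index `u` of the
`K`-block of `P` whose lattice coordinates `u.2` are `depth P 2`-deep, the finite shell of the block configuration
at the index `Fintype.equivFin _ u` (other block points within `6/5`, recentred, rescaled by `a⁻¹`) is the periodic
shell `shell P (bpt P K u) a`.  Block points are distinct points of `P` (`bpt_mem`, `blockConfig_injective`), and
every point of `P` within `6/5 < 2` of a `depth P 2`-deep block point is a block point (`exists_eq_toP_of_dist_lt`).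
[folklore] -/
theorem stub_blockShell : ∀ (P : PeriodicConfiguration 3) (K : ℕ) (u : BIdx P K),
    IsDeep K (depth P 2) u.2 → ∀ a : ℝ,
      ((Finset.univ.filter fun j : Fin (Fintype.card (BIdx P K)) =>
            j ≠ Fintype.equivFin (BIdx P K) u ∧
              dist (blockConfig P K (Fintype.equivFin (BIdx P K) u)) (blockConfig P K j) ≤ 6 / 5).image
          fun j => a⁻¹ • (blockConfig P K j - blockConfig P K (Fintype.equivFin (BIdx P K) u))) =
        shell P (bpt P K u) a := by
  intro P K u hu a
  have hxu : blockConfig P K (Fintype.equivFin (BIdx P K) u) = bpt P K u := by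
    rw [blockConfig_apply, Equiv.symm_apply_apply]
  ext z
  simp only [shell, Finset.mem_image, Finset.mem_filter, Finset.mem_univ, true_and,
    Set.Finite.mem_toFinset, Set.mem_inter_iff, Set.mem_sdiff, Metric.mem_closedBall,
    Set.mem_singleton_iff, hxu]
  constructor
  · rintro ⟨j, ⟨hji, hd⟩, rfl⟩
    refine ⟨blockConfig P K j, ⟨⟨?_, ?_⟩, ?_⟩, rfl⟩
    · rw [dist_comm]; exact hd
    · intro h
      apply hji
      apply blockConfig_injective P K
      rw [h, hxu]
    · rw [blockConfig_apply]; exact bpt_mem P K _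
  · rintro ⟨y, ⟨⟨hyd, hys⟩, hyP⟩, rfl⟩
    have hlt : dist (bpt P K u) y < 2 := by
      rw [dist_comm]; linarith
    have hne : (⟨y, hyP⟩ : P.points) ≠ toP P K u := fun h => hys (congrArg Subtype.val h)
    obtain ⟨v, hv, hvq⟩ := exists_eq_toP_of_dist_lt P K hu ⟨y, hyP⟩ hne hlt
    have hvy : bpt P K v = y := congrArg Subtype.val hvq
    refine ⟨Fintype.equivFin (BIdx P K) v, ⟨?_, ?_⟩, ?_⟩
    · intro h
      exact hv ((Fintype.equivFin (BIdx P K)).injective h)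
    · rw [blockConfig_apply, Equiv.symm_apply_apply, hvy, dist_comm]; exact hyd
    · rw [blockConfig_apply, Equiv.symm_apply_apply, hvy]

end Summit.AtomisticToContinuum.Crystallization.Theorems.ReggeStarCoercivityPeriodicStarCoercivity

end
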